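import Summits.ABC.ABC.Theses.NegOmegaAtlas
import Summits.ABC.ABC.Theorems.IneffectiveSubspaceUniformSadicTowerFourStubOmegaCountedTwo

/-!
# `NegOmegaAtlas.TwoSlotCell` (stmt-ABC-1231): the cell `ω(abc) ≤ 2` is closed, `c < 2·rad(abc)`

Verbatim the landed lemma `MixedRadical.omegaTwo_triple` (file
`Theorems/IneffectiveSubspaceUniformSadicTowerFourStubOmegaCountedTwo.lean`, p97349, proved for the crux
chain of `IneffectiveSubspace.UniformSadicTowerFour`, stmt-ABC-14937: the cell is `{1+1=2, (1, 2^x, Fermat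
prime), (1, Mersenne prime, 2^y), (1,2,3), (1,8,9)}` up to swapping, by the parity cases of Catalan).
Recorded here under the route decl of `NegOmegaAtlas` so that its support item closes.  Nothing else.
-/

-- `Summit.<Summit>.<Problem>` is the mandated summit-side namespace (CONVENTIONS §2); for the
-- single-conjunct summit `ABC` the two coincide, so the duplicate `ABC.ABC` is deliberate.
set_option linter.dupNamespace false

namespace Summit.ABC.ABC.Theorems

open Summit.ABC.ABC.Theorems.UniformSadicTowerFour.MixedRadical (omegaTwo_triple)

/-- **`NegOmegaAtlas.TwoSlotCell` holds**: every abc triple with `ω(abc) ≤ 2` has `c < 2·rad(abc)`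
(Gersonides / parity-Catalan; `omegaTwo_triple`). [folklore] -/
theorem twoSlotCell_proof : Summit.ABC.ABC.Theses.NegOmegaAtlas.TwoSlotCell := by
  unfold Summit.ABC.ABC.Theses.NegOmegaAtlas.TwoSlotCell
  intro a b c h hω
  exact omegaTwo_triple h.1 h.2.1 h.2.2.1 h.2.2.2 hω

end Summit.ABC.ABC.Theorems
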